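import Literature.Topology.FourManifolds.SurfaceGroupNielsenCoreCasePPaAux
import Literature.Topology.FourManifolds.SurfaceGroupNielsenCoreNoDoublePoint
import HarnessLib

/-!
# Nielsen's theorem, pillar CORE: a double point at the portals of two symbols, partners outside

Topic `Literature/Topology/FourManifolds`.  The case of the case analysis of a double point
`a < b` on the closed path of a potential-minimal configuration (Zieschang–Vogt–Coldewey, LNM 835,
proof of Thm. 5.3.2 with Lemma 5.3.4, in the minimal-counterexample recasting of
`SurfaceGroupNielsenCoreFrame.lean`) in which both cuts are portals of two different symbols —
`a` cuts the kernel of `k` between the slots `sa - 1 | sa` of its value `V` (`|V| = n`), `b` cuts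
the kernel of `k' ≠ k` between the slots `sb - 1 | sb` of its value `V'` (`|V'| = n'`),
`k' ≠ k̄` — and BOTH partner occurrences `k̄`, `k̄'` are OUTSIDE the subloop `[a, b)`.

The crossing edges of the fixation are the formal edges at the post-cut slots `(k, q)`,
`sa ≤ q`, whose far ends are head slots of `k̄` of level `n - 1 - q`, and the formal edges at
the pre-cut slots `(k', q')`, `q' < sb`, whose far ends are tail slots of `k̄'` of level `q'`
(`SurfaceGroupNielsenCoreSides.lean`).  The parity principle (`ppa_levels_match`) gives
`n - sa = sb` and puts the two edges of each level on one component, where a head and a tail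
carry inverse letters; hence `V'[0, sb) = (V[sa, n))⁻¹`, the identity `E_{k'} = E_{k+1}` of the
start vertices, and the block of the inside occurrences `k + 1, …, k' - 1` has trivial value.
It is symbol-closed (Claim (A)) and proper, so it decomposes the relator — unless it is empty
(`k' = k + 1`), in which case the junction `k | k'` of the closed path would cancel.

## References

* H. Zieschang, E. Vogt, H.-D. Coldewey, *Surfaces and Planar Discontinuous Groups*, LNM 835
  (1980), proof of Thm. 5.3.2 and Lemma 5.3.4. [ZieschangVogtColdewey1980]
-/

noncomputable section

namespace Literature.Topology.FourManifolds

open Literature.GroupTheory.CombinatorialGroupTheory CycFactors List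

namespace SurfaceGroup

namespace Config

variable {g : ℕ} {φ : surfaceGen g → SurfaceGroup g}

section PPoo

variable (hg : 2 ≤ g) (hK : RelatorKilled φ) (hI : Indecomposable φ) (hM : MarkedNontrivial φ)
  (κ : Config φ) (hmin : κ.IsMin) (d : κ.DoublePoint)
include hg hK hI hM hmin

omit hK in
/-- **No double point at the portals of two symbols with both partners outside.**
[cite: ZieschangVogtColdewey1980, proof of Thm. 5.3.2 and Lemma 5.3.4] -/
theorem false_of_doublePoint_PP_oo {k k' : ℕ} (hPa : κ.PortalAt d.a k) (hPb : κ.PortalAt d.b k')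
    (hkk' : k' ≠ κ.bar k) (hne : k' ≠ k) (hk : κ.Outside d.a d.b (κ.bar k))
    (hk' : κ.Outside d.a d.b (κ.bar k')) : False := by
  have hg1 : 1 ≤ g := by omega
  have hN := κ.cycNielsen_U hg1 hI hM hmin
  have hU := κ.U_ne_nil hg1
  have hbar := κ.isPairing_bar
  have hab := d.lt
  have hbℓ := d.lt_length
  have hkm : k < κ.w.length := κ.lt_length_of_portalAt hPa (hab.trans hbℓ).le
  have hk'm : k' < κ.w.length := κ.lt_length_of_portalAt hPb hbℓ.le
  have hkU : k < κ.U.length := by rw [length_U]; exact hkm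
  have hk'U : k' < κ.U.length := by rw [length_U]; exact hk'm
  have hbkm : κ.bar k < κ.w.length := κ.bar_lt hkm
  have hbk'm : κ.bar k' < κ.w.length := κ.bar_lt hk'm
  have hbb : κ.bar (κ.bar k) = k := κ.bar_bar hkm
  have hbb' : κ.bar (κ.bar k') = k' := κ.bar_bar hk'm
  have ha1 := hPa.1
  have ha2 := hPa.2
  have hb1 := hPb.1
  have hb2 := hPb.2
  -- `k < k'`
  have hkk : k < k' := by
    rcases Nat.lt_or_gt_of_ne hne with h | h
    · have := κ.Kend_le_Kstart_of_lt h
      omega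
    · exact h
  have hsep : ∀ j, ¬ (κ.PortalAt d.a j ∧ κ.PortalAt d.b j) := by
    rintro j ⟨hja, hjb⟩
    have e1 := κ.portalAt_unique hja hPa
    have e2 := κ.portalAt_unique hjb hPb
    omega
  have hP2 := DoublePoint.kpos_mem_iff_of_chainEnd κ hg1 hI hM hmin d
  -- numerical data of `k` and `k'`
  set n := (fac κ.U k).length with hn
  set n' := (fac κ.U k').length with hn'
  set c₂ := jc κ.U k with hc₂
  have hcc : jc κ.U (cpred κ.U k) + c₂ < n := hN.jc_add_jc_lt hU k
  have hcc' : jc κ.U (cpred κ.U k') + jc κ.U k' < n' := hN.jc_add_jc_lt hU k'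
  set sa := κ.slotAt k d.a with hsa
  set sb := κ.slotAt k' d.b with hsb
  obtain ⟨hc₁sa, hsan⟩ := κ.slotAt_bounds_of_portalAt hg1 hI hM hmin hPa
  obtain ⟨hc₁sb, hsbn⟩ := κ.slotAt_bounds_of_portalAt hg1 hI hM hmin hPb
  have hnbar : (fac κ.U (κ.bar k)).length = n := hbar.length_fac_bar hkU
  have hnbar' : (fac κ.U (κ.bar k')).length = n' := hbar.length_fac_bar hk'U
  -- the side function and (P2)
  let s : ℕ × ℕ → Bool := fun σ => decide (κ.SideIn d.a d.b σ)
  have hP2s : ∀ τ, IsKernelSlot κ.U τ → s τ = s (chainEnd κ.U κ.bar τ) := fun τ hτ =>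
    κ.decide_sideIn_eq_decide_sideIn_chainEnd hg1 hI hM hmin hab hsep hP2 hτ
  -- the crossing formal edges at the slots of `k` and of `k'`
  have hXk : ∀ q, IsCrossing s (fedge κ.U κ.bar (k, q)) ↔ sa ≤ q := fun q =>
    isCrossing_fedge.trans ((κ.fcross_iff_decide_ne _ _ _).symm.trans
      (κ.fcross_iff_of_portalAt_left_of_outside hg1 hI hM hmin hab hsep hPa hk q))
  have hXk' : ∀ q, IsCrossing s (fedge κ.U κ.bar (k', q)) ↔ q < sb := fun q =>
    isCrossing_fedge.trans ((κ.fcross_iff_decide_ne _ _ _).symm.trans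
      (κ.fcross_iff_of_portalAt_right_of_outside hg1 hI hM hmin hab hsep hPb hk' q))
  -- their cancelled ends: heads of `k̄` of level `n - 1 - q`, tails of `k̄'` of level `q`
  have hHk : ∀ q, sa ≤ q → q < n → IsHeadSlot κ.U (fpartner κ.U κ.bar (k, q)) := fun q hq hqn =>
    κ.isHeadSlot_of_portalAt_left_of_outside hg1 hI hM hmin hab hsep hP2 hkm hPa hk hq hqn
  have hTk' : ∀ q, q < sb → IsTailSlot κ.U (fpartner κ.U κ.bar (k', q)) := fun q hq =>
    κ.isTailSlot_of_portalAt_right_of_outside hg1 hI hM hmin hab hsep hP2 hk'm hPb hk' hq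
  have hLk : ∀ q, sa ≤ q → q < n → level κ.U (fpartner κ.U κ.bar (k, q)) = n - 1 - q :=
    fun q hq hqn => by
    rw [(hHk q hq hqn).level_eq hN]
    simp only [fpartner, ← hn]
  have hLk' : ∀ q, q < sb → level κ.U (fpartner κ.U κ.bar (k', q)) = q := fun q hq => by
    rw [(hTk' q hq).level_eq hN]
    simp only [fpartner, hnbar']
    omega
  -- PARITY: `n - sa = sb`, and the two crossing edges of level `e < sb` share a component
  obtain ⟨hsasb, hpair⟩ := ppa_levels_match (E₁ := fun e => fedge κ.U κ.bar (k, n - 1 - e))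
    (E₂ := fun e => fedge κ.U κ.bar (k', e)) (A := n - sa) (B := sb) hN hU hbar hP2s
    (fun e he => ⟨isEdge_fedge ⟨hkU, by simp only; omega⟩, (hXk _).2 (by omega),
      fpartner κ.U κ.bar (k, n - 1 - e), mem_fedge.2 (Or.inr rfl),
      by rw [hLk _ (by omega) (by omega)]; omega⟩)
    (fun e he => ⟨isEdge_fedge ⟨hk'U, by simp only; omega⟩, (hXk' e).2 he,
      fpartner κ.U κ.bar (k', e), mem_fedge.2 (Or.inr rfl), hLk' e he⟩)
    (fun ε hε hc => by
      rcases κ.ppa_crossing_edge_cases hg1 hI hM hmin hab hbℓ hsep hP2 hPa hPb hε hc with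
        ⟨q, hqn, -, rfl⟩ | ⟨q, hqn, -, rfl⟩
      · have hq : sa ≤ q := (hXk q).1 hc
        exact Or.inl ⟨n - 1 - q, by omega, by simp only [show n - 1 - (n - 1 - q) = q by omega]⟩
      · exact Or.inr ⟨q, (hXk' q).1 hc, rfl⟩)
  -- LETTERS: `V'[e] = (V[n - 1 - e])⁻¹` for `e < sb` (a head and a tail on one component)
  have hletter : ∀ e, e < sb →
      (fac κ.U k')[e]? = ((fac κ.U k)[n - 1 - e]?).map fun z => (z.1, !z.2) := by
    intro e he
    have hσ : IsSlot κ.U (k, n - 1 - e) := ⟨hkU, by simp only; omega⟩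
    have hτ : IsSlot κ.U (k', e) := ⟨hk'U, by simp only; omega⟩
    refine ppa_getElem?_of_sameComp_fpartner hN hU hbar hσ hτ
      (hpair e (by omega) _ (mem_fedge.2 (Or.inr rfl)) _ (mem_fedge.2 (Or.inr rfl))) ?_
    rw [(hTk' e he).slotType_eq, (hHk (n - 1 - e) (by omega) (by omega)).slotType_eq hN hU]
    decide
  -- THE WORD IDENTITY: `V'[0, sb) = (V[sa, n))⁻¹`
  have htake : (fac κ.U k').take sb = FreeGroup.invRev ((fac κ.U k).drop sa) := by
    refine ppa_eq_invRev_of_getElem? (by simp only [length_drop, length_take]; omega) fun i hi => ?_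
    rw [length_take] at hi
    rw [getElem?_take_of_lt (by omega), length_drop, getElem?_drop,
      show sa + (n - sa - 1 - i) = n - 1 - i by omega]
    exact hletter i (by omega)
  -- THE VERTEX IDENTITY `E_{k+1} = E_{k'}`
  have hva : κ.absv d.a = κ.occStart k * proj g (FreeGroup.mk ((fac κ.U k).take sa)) := by
    have e : kpos κ.U (k, sa) = d.a := κ.kpos_slotAt ha1.le
    rw [← e]
    exact κ.absv_kpos hN hkm (by omega) (by omega)
  have hvb : κ.absv d.b = κ.occStart k' * proj g (FreeGroup.mk ((fac κ.U k').take sb)) := by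
    have e : kpos κ.U (k', sb) = d.b := κ.kpos_slotAt hb1.le
    rw [← e]
    exact κ.absv_kpos hN hk'm (by omega) (by omega)
  have hvab : κ.absv d.a = κ.absv d.b := (κ.absv_eq_absv_iff _ _).2 d.pv_eq
  have hocc : κ.occStart (k + 1) = κ.occStart k' := by
    have e1 : κ.occStart k' = κ.absv d.b * (proj g (FreeGroup.mk ((fac κ.U k').take sb)))⁻¹ := by
      rw [hvb, mul_inv_cancel_right]
    rw [e1, ← hvab, hva, htake, ← FreeGroup.inv_mk, map_inv, inv_inv, mul_assoc, ← map_mul,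
      FreeGroup.mul_mk, List.take_append_drop, κ.occStart_mul_proj_fac hkm]
  -- THE BLOCK `k + 1, …, k' - 1` of the inside occurrences is closed under the pairing
  have hblock : ∀ j, j < κ.w.length → k + 1 ≤ j → j < k' → k + 1 ≤ κ.bar j ∧ κ.bar j < k' := by
    intro j hj hj1 hj2
    have hin : κ.Inside d.a d.b j := κ.ppa_inside_of_between hPa hPb hj1 hj2
    have e1 : κ.bar j ≠ k := fun h =>
      κ.not_outside_of_inside hg1 hI hM hmin hin (by rw [← κ.bar_bar hj, h]; exact hk)
    have e2 : κ.bar j ≠ k' := fun h =>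
      κ.not_outside_of_inside hg1 hI hM hmin hin (by rw [← κ.bar_bar hj, h]; exact hk')
    have := κ.ppa_bar_between hg1 hI hM hmin hP2 hPa hPb hj hj1 hj2 e1 e2
    omega
  by_cases hempty : k' = k + 1
  · /- DEGENERATE: no inside occurrence; then the junction `k | k'` of the closed path would
    cancel: the head cancellation of `k'` is the tail cancellation `c₂ < sb` of `k`, and
    `V'[c₂] = (V[n - 1 - c₂])⁻¹`. -/
    subst hempty
    have hc : jc κ.U (cpred κ.U (k + 1)) = c₂ := jc_cpred_succ κ.U k
    have hx : (fac κ.U k)[n - 1 - c₂]? = some ((fac κ.U k)[n - 1 - c₂]'(by omega)) :=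
      getElem?_eq_getElem _
    set x := (fac κ.U k)[n - 1 - c₂]'(by omega) with hx'
    have hlet := hletter c₂ (by omega)
    rw [hx, Option.map_some] at hlet
    have key := hN.kernel_junction hU k x
      (by rw [Option.mem_def, hN.getLast?_kernel hU k, show n - c₂ - 1 = n - 1 - c₂ by omega, hx])
      (x.1, !x.2) (by rw [Option.mem_def, hN.head?_kernel_succ hU k, hlet]) rfl
    exact Bool.not_ne_self _ key.symm
  · /- the inside occurrences form a non-empty proper symbol-closed block with trivial value -/
    exact false_of_occStart_eq hI κ (j₁ := k + 1) (j₂ := k') (by omega) (by omega) (by omega)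
      (κ.blockClosed_of_bar hblock) hocc

end PPoo

end Config

end SurfaceGroup

end Literature.Topology.FourManifolds

end
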